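/-
Copyright (c) 2026 the pub-hodgecm-mathlib formalisation cell (harness21).  Prover seat hodgecm-mathlib-F0P2-p11 (g0) (L1; LEAD F0P6-plan (g14) BATCH #52 (8) «#41 … (h4) F0P2-p11»;
#41 TOP ★ ed. 7∕8 KIND 1), Track B «K2-LIT» ∕ hLiu418 #184♮, ROAD Φ, G5-b = Φ7-3: THE «CELLS CUT» OF KIND 1 — the TOP's rank-one identification letter `hRK₁` is the Bruhat-cell
decomposition ★ Φ2; the content is relocated to the two cell letters (line term `Eb`, singular big-cell term `ρa·Ea`).  THEOREMS ONLY.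
-/
import Summits.HodgeConjecture.HodgeConjecture.Theorems.K2LiuSiegelEisensteinRankOneTermPackageInstanceWeighted   -- ★ p861664 `exists_kindOne_packages_sixLetters`
import Summits.HodgeConjecture.HodgeConjecture.Theorems.K2LiuFourierCoeffDeltaContinuous                          -- ★ p861715 `hRKc`, `exists_bound_mul_of_unipDeltaRat_invariant`
import Summits.HodgeConjecture.HodgeConjecture.Theorems.K2LiuSiegelEisensteinCoeffCells                            -- ★ Φ2 `fourierCoeffDelta_eisensteinSeriesDelta_of_ne_one`, (T2′)
import Summits.HodgeConjecture.HodgeConjecture.Theorems.K2LiuSiegelEisensteinConstantTermFiniteness                -- ★ ed. 4a′ `lintegral_tsum_enorm_mul_weight_ne_top` (O41.4's `hH`)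
import HarnessLib

/-!
# Crux `HLiu418`, socket #41, KIND 1 — the «CELLS CUT»: `hRK₁` of ★ ed. 7∕8 from the Bruhat cells ★ Φ2, and the SIX kind-1 letters of the TOP from two cell letters
# (`Eb` = the normalised middle-cell term, `ρa·Ea` = the normalised singular big-cell term)

Cell `hodgecm-mathlib`, crux item hLiu418 = `stmt-HodgeConjecture-24832` (helper lane, count-neutral); squad K2 ∕ K2Liu, LEAD F0P6-plan (g14) (BATCH #52 (8): (h4) = F0P2-p11),
desk = #41 TOP author K2E5-p17 (g8); prover F0P2-p11 (g0).  THEOREMS ONLY (no `def`, no `instance`, no notation, no named-fact hypothesis, no `sorry`).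

THE CUT (F0P2-p11 2026-09-04T16:14:31Z).  ★ ed. 7∕8 take the rank-one TERM DATA `(ι, a, ρb, ρa, G, Eb, Ea)` of ★ p861664 as data, so the payer may choose **`ι S := Unit`, `a := 1`,
`ρb := 1`**, `G = (s − ½)·ρa`, `Eb S s h :=` the NORMALISED MIDDLE-CELL TERM and `ρa(s)·Ea(s,h) :=` the NORMALISED SINGULAR BIG-CELL TERM of the rank-one coefficient; then the
identification letter `hRK₁` IS ★ Φ2 `K2LiuSiegelEisensteinCoeffCells.fourierCoeffDelta_eisensteinSeriesDelta_of_ne_one` (`E_S = (∫β)⁻¹•(W_S + MID_S)` for `ψ_S ≠ 1`, i.e. `S ≠ 0`,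
★ (T2′)), at a compactly supported covering weight (O41.4's `hH` ★ ed. 4a′ `lintegral_tsum_enorm_mul_weight_ne_top`) reached from ANY covering weight by ★ Φ1 weight independence
`fourierCoeffDelta_eq_of_isCoveringWeight` (`E(·; f_s)` is continuous ★ G8, left-`H(L⁺)`-invariant ★ #10b, bounded along `N_Δ(𝔸)`-orbits ★ p861715 §2).
* §1 **`fourierCoeffDelta_rankOne_eq_of_cells`** — for ONE index `S ≠ 0` and ONE `s` with `n∕2 < re s`: if `c•MID_S = Eb` and `c•W_S = ρa·Ea` at every Haar `νN` and every COMPACTLY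
  SUPPORTED covering weight (`c = (∫β dνN)⁻¹`), then `E_S(h; f_s) = Eb(h) + ρa·Ea(h)` at EVERY Haar `νN` and EVERY covering weight `β`.
* §2 **`exists_kindOne_sixLetters_of_cells`** — the SIX kind-1 binders `(Ec₁, h1off, hd₁, hc₁, hcoef₁, hmaj₁, hgr₁)` of ★ ed. 3b (consumed by ★ ed. 7∕8 through ★ p861664
  `exists_kindOne_packages_sixLetters`) from the CELL LETTERS BY VALUE: `Eb` (holomorphic on `{0<re}` in `s`, weighted growth `ub`), `ρa, G, Ea` (`G = (s − ½)ρa` holomorphic, `Ea`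
  holomorphic, weighted growth `uG` of `G·Ea`), `Summable (ub + uG)`, and the two cell identities on `n∕2 < re s` at compactly supported weights; `hRK₁` by §1, `hRKc` by ★ p861715,
  `ι := Unit`, `a := 1`, `ρb := 1`, `ua := 1`, `N₀ := 1`.
WHAT THIS BUYS.  KIND 1 of the TOP no longer mentions term data, `Σ_j`, Godement sections or the (u-0c)∕I-lineage: its by-value residue is exactly the two CELL ORGANS —
K1-b «LINE TERM» (`Eb`: the (b) corner-line integral of ★ p861327 `exists_middle_cell_rankOne_eq_corner_integral`, holomorphy∕growth on `{0<re}` = carrier-«A» rank-one Whittaker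
theory) and K1-a «SINGULAR BIG-CELL TERM» (`ρa·Ea`: ★ p861405 `exists_whittakerDelta_rankOne_eq_corner_integral`, the `N_χ(𝔸)`-period, GL₂ Gindikin–Karpelevich, pole `½` in `ρa`)
— plus the summable weights (R-3).
References: [KudlaRallis1994] §2; [MoeglinWaldspurger1995] II.1.7, IV.1.8–IV.1.11; [Tan1999] §3, §4 Prop. 4.8; [Shimura1997] §18.3–18.5.
HONEST LABEL.  Count-neutral helper, hypothesis-first (the cell letters are open by name); `HC_CM` is proved only modulo the 7 printed citations (2 remaining named inputs:
hLiu418 = `stmt-HodgeConjecture-24832`, h413 = `stmt-HodgeConjecture-24833`) until rung 0 closes.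
-/

set_option autoImplicit false
set_option linter.dupNamespace false -- the mandated namespace repeats `HodgeConjecture.HodgeConjecture`

noncomputable section

open scoped Matrix ENNReal NNReal Topology ComplexConjugate
open NumberField IsDedekindDomain MeasureTheory MeasureTheory.Measure Filter Set Function Metric
open Literature.NumberTheory.Automorphic Literature.NumberTheory.Automorphic.UnitaryGroup Literature.NumberTheory.GaloisRepresentations
open Literature.NumberTheory.GelbartRogawski1991 Literature.NumberTheory.GelbartRogawski1991.GRConstruction
open Literature.NumberTheory.K2Lit.SiegelDoubled Literature.MeasureTheory.Group
open UnitaryDualPair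

namespace Summit.HodgeConjecture.HodgeConjecture.Cruxes.HLiu418.K2LiuSiegelEisensteinRankOneCellsAssembly

open K2LiuSiegelUnipotentFourierDefs K2LiuSiegelUnipotentCharacters K2LiuUnipotentCoveringWeight K2LiuSiegelFourierCoeffDelta
open K2LiuSiegelEisensteinCoeffCells (fourierCoeffDelta_eisensteinSeriesDelta_of_ne_one exists_unipDeltaChar_ne_one_of_ne_zero)
open K2LiuSiegelEisensteinConstantTermFiniteness (lintegral_tsum_enorm_mul_weight_ne_top)
open K2LiuSiegelEisensteinContinuous (continuous_eisensteinSeriesDelta)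
open K2LiuSiegelEisensteinDoubledLeftInvariant (siegelEisensteinDoubledLeftInvariant)
open K2LiuFourierCoeffDeltaContinuous (exists_bound_mul_of_unipDeltaRat_invariant continuous_fourierCoeffDelta_eisensteinFamilyDelta)
open K2LiuUnipotentCocompact (exists_isCompact_cover_unipDelta)
open K2LiuUnipDeltaConjMeasurePreserving (lintegral_ne_zero_of_isCoveringWeight)
open K2LiuSiegelEisensteinRankOneTermPackageInstanceWeighted (exists_kindOne_packages_sixLetters)

variable (L : Type) [Field L] [NumberField L] [IsCMField L]
variable {N M n : ℕ} (e : Fin N × Fin M ≃ Fin n)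
  (dV : Fin N → L) (hdV : ∀ i, IsCMField.complexConj L (dV i) = dV i)
  (dW : Fin M → L) (hdW : ∀ i, IsCMField.complexConj L (dW i) = dW i)

/-! ## §1 One index, one `s`: the coefficient from the two cell letters, at every carrier -/

/-- **THE RANK-ONE COEFFICIENT FROM ITS CELLS, AT EVERY CARRIER.**  `χ` unitary, `f ∈ I(s, χ)` continuous, `n∕2 < re s`, `S ≠ 0` a `T_L`-skew index; if at every Haar `νN` and every
COMPACTLY SUPPORTED `N_Δ(L⁺)`-covering weight `β` (`β ≤ 𝟙_K`, `K` compact, `0 < ∫β < ∞`) the normalised cells are `(∫β)⁻¹•MID_S(h) = Eb h` and `(∫β)⁻¹•W_S(f)(h) = ρa·Ea h`, then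
`E_S(h; f) = fourierCoeffDelta νN β S (E(·; f)) h = Eb h + ρa·Ea h` at EVERY Haar `νN` and EVERY covering weight `β` (★ Φ1 weight independence to a compactly supported weight on the
cocompact cover ★ (C0), then ★ Φ2's cells with O41.4's `hH` ★ ed. 4a′). [cite: KudlaRallis1994, §2] [cite: MoeglinWaldspurger1995, II.1.7] [cite: Tan1999, §3] -/
theorem fourierCoeffDelta_rankOne_eq_of_cells (hdV0 : ∀ i, dV i ≠ 0) (hdW0 : ∀ i, dW i ≠ 0) (hn : 0 < n)
    [MeasurableSpace (unipDelta L e dV hdV dW hdW)] [BorelSpace (unipDelta L e dV hdV dW hdW)]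
    (wq : unipDeltaRat L e dV hdV dW hdW → ratH L e dV hdV dW hdW)
    (hwq : ∀ ν, ((wq ν : ratH L e dV hdV dW hdW) : HA L e dV hdV dW hdW) = weylDelta L e dV hdV dW hdW * ((ν : unipDelta L e dV hdV dW hdW) : HA L e dV hdV dW hdW))
    {χ : HeckeCharacter L} (hχ : χ.IsUnitary) {s : ℂ} (hs : (n : ℝ) / 2 < s.re)
    {f : HA L e dV hdV dW hdW → ℂ} (hf : IsSiegelDeltaSection L e dV hdV dW hdW χ s f) (hfc : Continuous f)
    {S : Matrix (Fin n) (Fin n) L}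
    (hS : S ∈ skewMatrices ((IsCMField.complexConj L : L ≃ₐ[Fp L] L) : L →+* L) ((gramR L e dV hdV dW hdW).map (algebraMap (Fp L) L))) (hS0 : S ≠ 0)
    (Eb Ea : HA L e dV hdV dW hdW → ℂ) (ρa : ℂ)
    (hEb : ∀ (νN : Measure (unipDelta L e dV hdV dW hdW)) [νN.IsHaarMeasure] (β : unipDelta L e dV hdV dW hdW → ℝ≥0∞),
      IsCoveringWeight (unipDeltaRat L e dV hdV dW hdW) β → ∫⁻ u, β u ∂νN ≠ 0 → ∫⁻ u, β u ∂νN ≠ ∞ →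
      ∀ K : Set (unipDelta L e dV hdV dW hdW), IsCompact K → (∀ u, β u ≤ K.indicator 1 u) → ∀ h : HA L e dV hdV dW hdW,
        ((∫⁻ u, β u ∂νN).toReal⁻¹ : ℝ) •
          (∫ u, (β u).toReal • (conj (unipDeltaChar L e dV hdV dW hdW S (u : HA L e dV hdV dW hdW) : ℂ) *
            (∑' q : ↥(({Quotient.mk (MulAction.orbitRel (siegelDeltaRat L e dV hdV dW hdW) (ratH L e dV hdV dW hdW)) 1} ∪
              Set.range (fun ν : unipDeltaRat L e dV hdV dW hdW =>
                (Quotient.mk (MulAction.orbitRel (siegelDeltaRat L e dV hdV dW hdW) (ratH L e dV hdV dW hdW)) (wq ν) :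
                  SiegelDeltaQuot L e dV hdV dW hdW)))ᶜ : Set (SiegelDeltaQuot L e dV hdV dW hdW)),
            f ((((Quotient.out (q : SiegelDeltaQuot L e dV hdV dW hdW) : ratH L e dV hdV dW hdW) : HA L e dV hdV dW hdW)) *
              ((u : HA L e dV hdV dW hdW) * h)))) ∂νN) = Eb h)
    (hEa : ∀ (νN : Measure (unipDelta L e dV hdV dW hdW)) [νN.IsHaarMeasure] (β : unipDelta L e dV hdV dW hdW → ℝ≥0∞),
      IsCoveringWeight (unipDeltaRat L e dV hdV dW hdW) β → ∫⁻ u, β u ∂νN ≠ 0 → ∫⁻ u, β u ∂νN ≠ ∞ →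
      ∀ K : Set (unipDelta L e dV hdV dW hdW), IsCompact K → (∀ u, β u ≤ K.indicator 1 u) → ∀ h : HA L e dV hdV dW hdW,
        ((∫⁻ u, β u ∂νN).toReal⁻¹ : ℝ) • whittakerDelta L e dV hdV dW hdW νN S f h = ρa * Ea h)
    (νN : Measure (unipDelta L e dV hdV dW hdW)) [νN.IsHaarMeasure] {β : unipDelta L e dV hdV dW hdW → ℝ≥0∞}
    (hβ : IsCoveringWeight (unipDeltaRat L e dV hdV dW hdW) β) (h : HA L e dV hdV dW hdW) :
    fourierCoeffDelta L e dV hdV dW hdW νN β S (eisensteinSeriesDelta L e dV hdV dW hdW f) h = Eb h + ρa * Ea h := by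
  haveI : NeZero (n + n) := ⟨by omega⟩
  haveI : Countable (unipDeltaRat L e dV hdV dW hdW) := countable_unipDeltaRat L e dV hdV dW hdW
  -- a compactly supported covering weight on the cocompact cover (★ (C0))
  obtain ⟨K, hK, hcover⟩ := exists_isCompact_cover_unipDelta L e dV hdV dW hdW hdV0 hdW0
  obtain ⟨β₀, hβ₀, -, hβ₀K, hβ₀top⟩ := exists_isCoveringWeight_unipDeltaRat_lintegral_ne_top L e dV hdV dW hdW νN hK hcover
  have hβ₀0 : ∫⁻ u, β₀ u ∂νN ≠ 0 := lintegral_ne_zero_of_isCoveringWeight _ (NeZero.ne _) (unipDeltaRat L e dV hdV dW hdW) hβ₀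
  -- `E(·; f)`: continuous, left-`H(L⁺)`-invariant, bounded along `N_Δ(𝔸)`-orbits
  have hEc : Continuous (eisensteinSeriesDelta L e dV hdV dW hdW f) := continuous_eisensteinSeriesDelta L e dV hdV hdV0 dW hdW hdW0 hχ hs hf hfc
  have hEinv : ∀ (γ : unipDeltaRat L e dV hdV dW hdW) (x : HA L e dV hdV dW hdW),
      eisensteinSeriesDelta L e dV hdV dW hdW f (((γ : unipDelta L e dV hdV dW hdW) : HA L e dV hdV dW hdW) * x) = eisensteinSeriesDelta L e dV hdV dW hdW f x :=
    fun γ x => siegelEisensteinDoubledLeftInvariant L e dV hdV dW hdW χ s f hf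
      ⟨((γ : unipDelta L e dV hdV dW hdW) : HA L e dV hdV dW hdW), (mem_unipDeltaRat_iff L e dV hdV dW hdW _).1 γ.2⟩ x
  -- weight independence: `β ↦ β₀`
  have hind : fourierCoeffDelta L e dV hdV dW hdW νN β S (eisensteinSeriesDelta L e dV hdV dW hdW f) h =
      fourierCoeffDelta L e dV hdV dW hdW νN β₀ S (eisensteinSeriesDelta L e dV hdV dW hdW f) h :=
    (fourierCoeffDelta_eq_of_isCoveringWeight L e dV hdV dW hdW νN hβ₀ hβ hβ₀top S (hEc.comp (continuous_subtype_val.mul continuous_const))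
      (exists_bound_mul_of_unipDeltaRat_invariant L e dV hdV dW hdW hdV0 hdW0 hEc hEinv h) fun γ u => by
        rw [Subgroup.coe_mul, mul_assoc, hEinv]).symm
  -- the cells at `β₀` (O41.4's `hH` ★ ed. 4a′; the twist is non-trivial ★ (T2′))
  obtain ⟨u₀, hu₀⟩ := exists_unipDeltaChar_ne_one_of_ne_zero (e := e) (dV := dV) (hdV := hdV) (dW := dW) (hdW := hdW) hdV0 hdW0 hS hS0
  have hH := lintegral_tsum_enorm_mul_weight_ne_top L e dV hdV dW hdW hdV0 hdW0 hχ hs hf hfc νN hβ₀top hK hβ₀K h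
  rw [hind, fourierCoeffDelta_eisensteinSeriesDelta_of_ne_one wq hwq hn νN hβ₀ hf hfc h hH S hu₀, smul_add,
    hEb νN β₀ hβ₀ hβ₀0 hβ₀top K hK hβ₀K h, hEa νN β₀ hβ₀ hβ₀0 hβ₀top K hK hβ₀K h, add_comm]

/-! ## §2 The six kind-1 letters of the TOP from the two cell letters -/

/-- **THE SIX KIND-1 LETTERS OF THE TOP FROM THE CELL LETTERS (the «cells cut», hypothesis-first).**  Binders: the datum (`dV i, dW j ≠ 0`, `0 < n`), `χ` unitary, a family of continuous
Siegel sections `f s ∈ I(s, χ)`, a pole set `P ∋ ½`, O41.4's rational Weyl presentation `(wq, hwq)`; THE CELL LETTERS BY VALUE: `Eb` (normalised middle-cell term: holomorphic on `{0<re}`,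
weighted growth `ub`), `ρa, G, Ea` (`G = (s − ½)ρa` holomorphic, `Ea` holomorphic, weighted growth `uG` of `G·Ea`), `Summable (ub + uG)`, and the two cell identities on `n∕2 < re s` at every
Haar `νN` and every compactly supported covering weight.  OUTPUT: `∃ Ec₁` with `h1off`, `hd₁`, `hc₁`, `hcoef₁`, `hmaj₁`, `hgr₁` — ★ p861664 `exists_kindOne_packages_sixLetters` at `ι := Unit`,
`a := 1`, `ρb := 1`, `ua := 1`, `N₀ := 1`, its `hRK` by §1 and its `hRKc` by ★ p861715. [cite: Tan1999, §4 Prop. 4.8] [cite: MoeglinWaldspurger1995, IV.1.8–IV.1.11] [cite: KudlaRallis1994, §2] -/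
theorem exists_kindOne_sixLetters_of_cells (hdV0 : ∀ i, dV i ≠ 0) (hdW0 : ∀ i, dW i ≠ 0) (hn : 0 < n)
    [MeasurableSpace (unipDelta L e dV hdV dW hdW)] [BorelSpace (unipDelta L e dV hdV dW hdW)]
    {χ : HeckeCharacter L} (hχ : χ.IsUnitary) (f : ℂ → HA L e dV hdV dW hdW → ℂ)
    (hf : ∀ s, IsSiegelDeltaSection L e dV hdV dW hdW χ s (f s)) (hfc : ∀ s, Continuous (f s)) (P : Finset ℂ) (hP : (1 / 2 : ℂ) ∈ P)
    (wq : unipDeltaRat L e dV hdV dW hdW → ratH L e dV hdV dW hdW)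
    (hwq : ∀ ν, ((wq ν : ratH L e dV hdV dW hdW) : HA L e dV hdV dW hdW) = weylDelta L e dV hdV dW hdW * ((ν : unipDelta L e dV hdV dW hdW) : HA L e dV hdV dW hdW))
    -- THE CELL LETTERS
    (Eb : skewMatrices ((IsCMField.complexConj L : L ≃ₐ[Fp L] L) : L →+* L) ((gramR L e dV hdV dW hdW).map (algebraMap (Fp L) L)) → ℂ → HA L e dV hdV dW hdW → ℂ)
    (hEbd : ∀ S x, DifferentiableOn ℂ (fun s => Eb S s x) {s : ℂ | 0 < s.re})
    (ρa G : skewMatrices ((IsCMField.complexConj L : L ≃ₐ[Fp L] L) : L →+* L) ((gramR L e dV hdV dW hdW).map (algebraMap (Fp L) L)) → ℂ → ℂ)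
    (hG : ∀ S, DifferentiableOn ℂ (G S) {s : ℂ | 0 < s.re}) (hGρ : ∀ S, ∀ s : ℂ, 0 < s.re → s ≠ 1 / 2 → G S s = (s - 1 / 2) * ρa S s)
    (Ea : skewMatrices ((IsCMField.complexConj L : L ≃ₐ[Fp L] L) : L →+* L) ((gramR L e dV hdV dW hdW).map (algebraMap (Fp L) L)) → ℂ → HA L e dV hdV dW hdW → ℂ)
    (hEad : ∀ S x, DifferentiableOn ℂ (fun s => Ea S s x) {s : ℂ | 0 < s.re})
    (ub uG : skewMatrices ((IsCMField.complexConj L : L ≃ₐ[Fp L] L) : L →+* L) ((gramR L e dV hdV dW hdW).map (algebraMap (Fp L) L)) → ℝ)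
    (hub : ∀ S, 0 ≤ ub S) (huG : ∀ S, 0 ≤ uG S)
    (hbg : ∀ z : ℂ, 0 < z.re → ∃ C A r : ℝ, 0 ≤ C ∧ 0 ≤ A ∧ 0 < r ∧ ∀ S (s : ℂ), dist s z < r → ∀ x : HA L e dV hdV dW hdW,
      ‖Eb S s x‖ ≤ C * ub S * adelicHeightGL (n + n) L (x : GL (Fin (n + n)) (AdeleRing (𝓞 L) L)) ^ A)
    (haG : ∀ z : ℂ, 0 < z.re → ∃ C A r : ℝ, 0 ≤ C ∧ 0 ≤ A ∧ 0 < r ∧ ∀ S (s : ℂ), dist s z < r → ∀ x : HA L e dV hdV dW hdW,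
      ‖G S s * Ea S s x‖ ≤ C * uG S * adelicHeightGL (n + n) L (x : GL (Fin (n + n)) (AdeleRing (𝓞 L) L)) ^ A)
    (hws : Summable fun S => ub S + uG S)
    -- THE CELL IDENTITIES on the convergence half-plane, at every Haar `νN` and every compactly supported covering weight
    (hEb : ∀ S : skewMatrices ((IsCMField.complexConj L : L ≃ₐ[Fp L] L) : L →+* L) ((gramR L e dV hdV dW hdW).map (algebraMap (Fp L) L)),
      (S : Matrix (Fin n) (Fin n) L) ≠ 0 → (S : Matrix (Fin n) (Fin n) L).det = 0 →
      ∀ (νN : Measure (unipDelta L e dV hdV dW hdW)) [νN.IsHaarMeasure] (β : unipDelta L e dV hdV dW hdW → ℝ≥0∞),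
      IsCoveringWeight (unipDeltaRat L e dV hdV dW hdW) β → ∫⁻ u, β u ∂νN ≠ 0 → ∫⁻ u, β u ∂νN ≠ ∞ →
      ∀ K : Set (unipDelta L e dV hdV dW hdW), IsCompact K → (∀ u, β u ≤ K.indicator 1 u) →
      ∀ (s : ℂ) (h : HA L e dV hdV dW hdW), (n : ℝ) / 2 < s.re →
        ((∫⁻ u, β u ∂νN).toReal⁻¹ : ℝ) •
          (∫ u, (β u).toReal • (conj (unipDeltaChar L e dV hdV dW hdW (S : Matrix (Fin n) (Fin n) L) (u : HA L e dV hdV dW hdW) : ℂ) *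
            (∑' q : ↥(({Quotient.mk (MulAction.orbitRel (siegelDeltaRat L e dV hdV dW hdW) (ratH L e dV hdV dW hdW)) 1} ∪
              Set.range (fun ν : unipDeltaRat L e dV hdV dW hdW =>
                (Quotient.mk (MulAction.orbitRel (siegelDeltaRat L e dV hdV dW hdW) (ratH L e dV hdV dW hdW)) (wq ν) :
                  SiegelDeltaQuot L e dV hdV dW hdW)))ᶜ : Set (SiegelDeltaQuot L e dV hdV dW hdW)),
            f s ((((Quotient.out (q : SiegelDeltaQuot L e dV hdV dW hdW) : ratH L e dV hdV dW hdW) : HA L e dV hdV dW hdW)) *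
              ((u : HA L e dV hdV dW hdW) * h)))) ∂νN) = Eb S s h)
    (hEa : ∀ S : skewMatrices ((IsCMField.complexConj L : L ≃ₐ[Fp L] L) : L →+* L) ((gramR L e dV hdV dW hdW).map (algebraMap (Fp L) L)),
      (S : Matrix (Fin n) (Fin n) L) ≠ 0 → (S : Matrix (Fin n) (Fin n) L).det = 0 →
      ∀ (νN : Measure (unipDelta L e dV hdV dW hdW)) [νN.IsHaarMeasure] (β : unipDelta L e dV hdV dW hdW → ℝ≥0∞),
      IsCoveringWeight (unipDeltaRat L e dV hdV dW hdW) β → ∫⁻ u, β u ∂νN ≠ 0 → ∫⁻ u, β u ∂νN ≠ ∞ →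
      ∀ K : Set (unipDelta L e dV hdV dW hdW), IsCompact K → (∀ u, β u ≤ K.indicator 1 u) →
      ∀ (s : ℂ) (h : HA L e dV hdV dW hdW), (n : ℝ) / 2 < s.re →
        ((∫⁻ u, β u ∂νN).toReal⁻¹ : ℝ) • whittakerDelta L e dV hdV dW hdW νN (S : Matrix (Fin n) (Fin n) L) (f s) h = ρa S s * Ea S s h) :
    ∃ Ec₁ : skewMatrices ((IsCMField.complexConj L : L ≃ₐ[Fp L] L) : L →+* L) ((gramR L e dV hdV dW hdW).map (algebraMap (Fp L) L)) → ℂ → HA L e dV hdV dW hdW → ℂ,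
      (∀ S : skewMatrices ((IsCMField.complexConj L : L ≃ₐ[Fp L] L) : L →+* L) ((gramR L e dV hdV dW hdW).map (algebraMap (Fp L) L)),
        ¬ ((S : Matrix (Fin n) (Fin n) L) ≠ 0 ∧ (S : Matrix (Fin n) (Fin n) L).det = 0) → ∀ s h, Ec₁ S s h = 0) ∧
      (∀ (S : skewMatrices ((IsCMField.complexConj L : L ≃ₐ[Fp L] L) : L →+* L) ((gramR L e dV hdV dW hdW).map (algebraMap (Fp L) L))) (h : HA L e dV hdV dW hdW),
        DifferentiableOn ℂ (fun s => Ec₁ S s h) {s : ℂ | 0 < s.re}) ∧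
      (∀ (S : skewMatrices ((IsCMField.complexConj L : L ≃ₐ[Fp L] L) : L →+* L) ((gramR L e dV hdV dW hdW).map (algebraMap (Fp L) L))) (s : ℂ),
        0 < s.re → Continuous (Ec₁ S s)) ∧
      (∀ (νN : Measure (unipDelta L e dV hdV dW hdW)) [νN.IsHaarMeasure] (β : unipDelta L e dV hdV dW hdW → ℝ≥0∞),
        IsCoveringWeight (unipDeltaRat L e dV hdV dW hdW) β → ∫⁻ u, β u ∂νN ≠ 0 → ∫⁻ u, β u ∂νN ≠ ∞ →
        ∀ S : skewMatrices ((IsCMField.complexConj L : L ≃ₐ[Fp L] L) : L →+* L) ((gramR L e dV hdV dW hdW).map (algebraMap (Fp L) L)),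
        (S : Matrix (Fin n) (Fin n) L) ≠ 0 → (S : Matrix (Fin n) (Fin n) L).det = 0 →
        ∀ (s : ℂ) (h : HA L e dV hdV dW hdW), (n : ℝ) / 2 < s.re →
          Ec₁ S s h = (∏ p ∈ P, (s - p)) * fourierCoeffDelta L e dV hdV dW hdW νN β (S : Matrix (Fin n) (Fin n) L) (eisensteinFamilyDelta L e dV hdV dW hdW f s) h) ∧
      (∀ z : ℂ, 0 < z.re → ∀ h₀ : HA L e dV hdV dW hdW, ∃ r > (0 : ℝ), ∃ V ∈ 𝓝 h₀,
        ∃ m : skewMatrices ((IsCMField.complexConj L : L ≃ₐ[Fp L] L) : L →+* L) ((gramR L e dV hdV dW hdW).map (algebraMap (Fp L) L)) → ℝ, Summable m ∧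
          ∀ s : ℂ, dist s z < r → ∀ h ∈ V, ∀ S, ‖Ec₁ S s h‖ ≤ m S) ∧
      (∀ z : ℂ, 0 < z.re → ∃ C A r : ℝ, 0 < r ∧ ∀ s : ℂ, dist s z < r → ∀ h : HA L e dV hdV dW hdW,
        (Summable fun S => ‖Ec₁ S s h‖) ∧ ∑' S, ‖Ec₁ S s h‖ ≤ C * adelicHeightGL (n + n) L (h : GL (Fin (n + n)) (AdeleRing (𝓞 L) L)) ^ A) := by
  refine exists_kindOne_packages_sixLetters L e dV hdV dW hdW hdV0 hdW0 hn f P hP (fun _ => Unit) (fun S _ s x => (1 : ℂ))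
    (fun S _ x => differentiableOn_const (1 : ℂ)) (fun _ _ => (1 : ℂ)) ρa G (fun S => differentiableOn_const (1 : ℂ)) hG hGρ
    (fun S _ s x => Eb S s x) (fun S _ s x => Ea S s x) (fun S _ x => hEbd S x) (fun S _ x => hEad S x)
    (fun _ => (1 : ℝ)) ub uG (fun _ => zero_le_one) hub huG 1 (fun _ => by simp) ?_ ?_ ?_ (by simpa only [one_mul] using hws) ?_
    (fun S => continuous_fourierCoeffDelta_eisensteinFamilyDelta L e dV hdV dW hdW hdV0 hdW0 hχ hf hfc (S : Matrix (Fin n) (Fin n) L))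
  · -- `hag` for `a := 1`, `ua := 1`
    intro z _
    refine ⟨1, 0, 1, zero_le_one, le_rfl, one_pos, fun S _ s _ x => ?_⟩
    rw [norm_one, Real.rpow_zero, mul_one, mul_one]
  · -- `hbg` for `ρb := 1`
    intro z hz
    obtain ⟨C, A, r, hC, hA, hr, hle⟩ := hbg z hz
    exact ⟨C, A, r, hC, hA, hr, fun S _ s hs x => by rw [one_mul]; exact hle S s hs x⟩
  · -- `haG`
    intro z hz
    obtain ⟨C, A, r, hC, hA, hr, hle⟩ := haG z hz
    exact ⟨C, A, r, hC, hA, hr, fun S _ s hs x => hle S s hs x⟩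
  · -- `hRK₁`: the cells (§1), summed over `ι S = Unit`
    intro S hS0 hSdet νN _ β hβ hβ0 hβtop s h hs
    rw [Fintype.sum_unique, one_mul, one_mul]
    exact fourierCoeffDelta_rankOne_eq_of_cells L e dV hdV dW hdW hdV0 hdW0 hn wq hwq hχ hs (hf s) (hfc s) S.2 hS0 (Eb S s) (Ea S s) (ρa S s)
      (fun νN _ β hβ hβ0 hβtop K hK hβK h => hEb S hS0 hSdet νN β hβ hβ0 hβtop K hK hβK s h hs)
      (fun νN _ β hβ hβ0 hβtop K hK hβK h => hEa S hS0 hSdet νN β hβ hβ0 hβtop K hK hβK s h hs) νN hβ h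

/-! ## §3 The same from the two CELL PACKAGES (the organ heads K1-b, K1-a as `∃`-packages) -/

/-- **THE SIX KIND-1 LETTERS OF THE TOP FROM THE TWO CELL PACKAGES.**  The organ heads in the shape their owners will land them: **K1-b «LINE TERM»**
`∃ Eb ub, holomorphy ∧ 0 ≤ ub ∧ Summable ub ∧ weighted growth ∧ ((∫β)⁻¹•MID_S(f_s) = Eb S s on n∕2 < re s, every Haar νN, every compactly supported covering weight)` and
**K1-a «SINGULAR BIG-CELL TERM»** `∃ ρa G Ea uG, G holomorphic ∧ G = (s − ½)ρa ∧ Ea holomorphic ∧ 0 ≤ uG ∧ Summable uG ∧ weighted growth of G·Ea ∧ ((∫β)⁻¹•W_S(f_s) = ρa·Ea …)`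
⇒ `∃ Ec₁` with the six kind-1 binders of the TOP (§2). [cite: Tan1999, §4 Prop. 4.8] [cite: MoeglinWaldspurger1995, IV.1.8–IV.1.11] [cite: KudlaRallis1994, §2] -/
theorem exists_kindOne_sixLetters_of_cellPackages (hdV0 : ∀ i, dV i ≠ 0) (hdW0 : ∀ i, dW i ≠ 0) (hn : 0 < n)
    [MeasurableSpace (unipDelta L e dV hdV dW hdW)] [BorelSpace (unipDelta L e dV hdV dW hdW)]
    {χ : HeckeCharacter L} (hχ : χ.IsUnitary) (f : ℂ → HA L e dV hdV dW hdW → ℂ)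
    (hf : ∀ s, IsSiegelDeltaSection L e dV hdV dW hdW χ s (f s)) (hfc : ∀ s, Continuous (f s)) (P : Finset ℂ) (hP : (1 / 2 : ℂ) ∈ P)
    (wq : unipDeltaRat L e dV hdV dW hdW → ratH L e dV hdV dW hdW)
    (hwq : ∀ ν, ((wq ν : ratH L e dV hdV dW hdW) : HA L e dV hdV dW hdW) = weylDelta L e dV hdV dW hdW * ((ν : unipDelta L e dV hdV dW hdW) : HA L e dV hdV dW hdW))
    -- K1-b «LINE TERM» package
    (hK1b : ∃ (Eb : skewMatrices ((IsCMField.complexConj L : L ≃ₐ[Fp L] L) : L →+* L) ((gramR L e dV hdV dW hdW).map (algebraMap (Fp L) L)) → ℂ → HA L e dV hdV dW hdW → ℂ) (ub : skewMatrices ((IsCMField.complexConj L : L ≃ₐ[Fp L] L) : L →+* L) ((gramR L e dV hdV dW hdW).map (algebraMap (Fp L) L)) → ℝ),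
      (∀ S x, DifferentiableOn ℂ (fun s => Eb S s x) {s : ℂ | 0 < s.re}) ∧ (∀ S, 0 ≤ ub S) ∧ Summable ub ∧
      (∀ z : ℂ, 0 < z.re → ∃ C A r : ℝ, 0 ≤ C ∧ 0 ≤ A ∧ 0 < r ∧ ∀ S (s : ℂ), dist s z < r → ∀ x : HA L e dV hdV dW hdW,
        ‖Eb S s x‖ ≤ C * ub S * adelicHeightGL (n + n) L (x : GL (Fin (n + n)) (AdeleRing (𝓞 L) L)) ^ A) ∧
      (∀ S : skewMatrices ((IsCMField.complexConj L : L ≃ₐ[Fp L] L) : L →+* L) ((gramR L e dV hdV dW hdW).map (algebraMap (Fp L) L)),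
          (S : Matrix (Fin n) (Fin n) L) ≠ 0 → (S : Matrix (Fin n) (Fin n) L).det = 0 →
          ∀ (νN : Measure (unipDelta L e dV hdV dW hdW)) [νN.IsHaarMeasure] (β : unipDelta L e dV hdV dW hdW → ℝ≥0∞),
          IsCoveringWeight (unipDeltaRat L e dV hdV dW hdW) β → ∫⁻ u, β u ∂νN ≠ 0 → ∫⁻ u, β u ∂νN ≠ ∞ →
          ∀ K : Set (unipDelta L e dV hdV dW hdW), IsCompact K → (∀ u, β u ≤ K.indicator 1 u) →
          ∀ (s : ℂ) (h : HA L e dV hdV dW hdW), (n : ℝ) / 2 < s.re →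
          ((∫⁻ u, β u ∂νN).toReal⁻¹ : ℝ) •
            (∫ u, (β u).toReal • (conj (unipDeltaChar L e dV hdV dW hdW (S : Matrix (Fin n) (Fin n) L) (u : HA L e dV hdV dW hdW) : ℂ) *
              (∑' q : ↥(({Quotient.mk (MulAction.orbitRel (siegelDeltaRat L e dV hdV dW hdW) (ratH L e dV hdV dW hdW)) 1} ∪
                Set.range (fun ν : unipDeltaRat L e dV hdV dW hdW =>
                  (Quotient.mk (MulAction.orbitRel (siegelDeltaRat L e dV hdV dW hdW) (ratH L e dV hdV dW hdW)) (wq ν) :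
                    SiegelDeltaQuot L e dV hdV dW hdW)))ᶜ : Set (SiegelDeltaQuot L e dV hdV dW hdW)),
              f s ((((Quotient.out (q : SiegelDeltaQuot L e dV hdV dW hdW) : ratH L e dV hdV dW hdW) : HA L e dV hdV dW hdW)) *
                ((u : HA L e dV hdV dW hdW) * h)))) ∂νN) = Eb S s h))
    -- K1-a «SINGULAR BIG-CELL TERM» package
    (hK1a : ∃ (ρa G : skewMatrices ((IsCMField.complexConj L : L ≃ₐ[Fp L] L) : L →+* L) ((gramR L e dV hdV dW hdW).map (algebraMap (Fp L) L)) → ℂ → ℂ) (Ea : skewMatrices ((IsCMField.complexConj L : L ≃ₐ[Fp L] L) : L →+* L) ((gramR L e dV hdV dW hdW).map (algebraMap (Fp L) L)) → ℂ → HA L e dV hdV dW hdW → ℂ) (uG : skewMatrices ((IsCMField.complexConj L : L ≃ₐ[Fp L] L) : L →+* L) ((gramR L e dV hdV dW hdW).map (algebraMap (Fp L) L)) → ℝ),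
      (∀ S, DifferentiableOn ℂ (G S) {s : ℂ | 0 < s.re}) ∧ (∀ S, ∀ s : ℂ, 0 < s.re → s ≠ 1 / 2 → G S s = (s - 1 / 2) * ρa S s) ∧
      (∀ S x, DifferentiableOn ℂ (fun s => Ea S s x) {s : ℂ | 0 < s.re}) ∧ (∀ S, 0 ≤ uG S) ∧ Summable uG ∧
      (∀ z : ℂ, 0 < z.re → ∃ C A r : ℝ, 0 ≤ C ∧ 0 ≤ A ∧ 0 < r ∧ ∀ S (s : ℂ), dist s z < r → ∀ x : HA L e dV hdV dW hdW,
        ‖G S s * Ea S s x‖ ≤ C * uG S * adelicHeightGL (n + n) L (x : GL (Fin (n + n)) (AdeleRing (𝓞 L) L)) ^ A) ∧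
      (∀ S : skewMatrices ((IsCMField.complexConj L : L ≃ₐ[Fp L] L) : L →+* L) ((gramR L e dV hdV dW hdW).map (algebraMap (Fp L) L)),
          (S : Matrix (Fin n) (Fin n) L) ≠ 0 → (S : Matrix (Fin n) (Fin n) L).det = 0 →
          ∀ (νN : Measure (unipDelta L e dV hdV dW hdW)) [νN.IsHaarMeasure] (β : unipDelta L e dV hdV dW hdW → ℝ≥0∞),
          IsCoveringWeight (unipDeltaRat L e dV hdV dW hdW) β → ∫⁻ u, β u ∂νN ≠ 0 → ∫⁻ u, β u ∂νN ≠ ∞ →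
          ∀ K : Set (unipDelta L e dV hdV dW hdW), IsCompact K → (∀ u, β u ≤ K.indicator 1 u) →
          ∀ (s : ℂ) (h : HA L e dV hdV dW hdW), (n : ℝ) / 2 < s.re →
          ((∫⁻ u, β u ∂νN).toReal⁻¹ : ℝ) • whittakerDelta L e dV hdV dW hdW νN (S : Matrix (Fin n) (Fin n) L) (f s) h = ρa S s * Ea S s h)) :
    ∃ Ec₁ : skewMatrices ((IsCMField.complexConj L : L ≃ₐ[Fp L] L) : L →+* L) ((gramR L e dV hdV dW hdW).map (algebraMap (Fp L) L)) → ℂ → HA L e dV hdV dW hdW → ℂ,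
      (∀ S : skewMatrices ((IsCMField.complexConj L : L ≃ₐ[Fp L] L) : L →+* L) ((gramR L e dV hdV dW hdW).map (algebraMap (Fp L) L)),
        ¬ ((S : Matrix (Fin n) (Fin n) L) ≠ 0 ∧ (S : Matrix (Fin n) (Fin n) L).det = 0) → ∀ s h, Ec₁ S s h = 0) ∧
      (∀ (S : skewMatrices ((IsCMField.complexConj L : L ≃ₐ[Fp L] L) : L →+* L) ((gramR L e dV hdV dW hdW).map (algebraMap (Fp L) L))) (h : HA L e dV hdV dW hdW),
        DifferentiableOn ℂ (fun s => Ec₁ S s h) {s : ℂ | 0 < s.re}) ∧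
      (∀ (S : skewMatrices ((IsCMField.complexConj L : L ≃ₐ[Fp L] L) : L →+* L) ((gramR L e dV hdV dW hdW).map (algebraMap (Fp L) L))) (s : ℂ),
        0 < s.re → Continuous (Ec₁ S s)) ∧
      (∀ (νN : Measure (unipDelta L e dV hdV dW hdW)) [νN.IsHaarMeasure] (β : unipDelta L e dV hdV dW hdW → ℝ≥0∞),
        IsCoveringWeight (unipDeltaRat L e dV hdV dW hdW) β → ∫⁻ u, β u ∂νN ≠ 0 → ∫⁻ u, β u ∂νN ≠ ∞ →
        ∀ S : skewMatrices ((IsCMField.complexConj L : L ≃ₐ[Fp L] L) : L →+* L) ((gramR L e dV hdV dW hdW).map (algebraMap (Fp L) L)),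
        (S : Matrix (Fin n) (Fin n) L) ≠ 0 → (S : Matrix (Fin n) (Fin n) L).det = 0 →
        ∀ (s : ℂ) (h : HA L e dV hdV dW hdW), (n : ℝ) / 2 < s.re →
          Ec₁ S s h = (∏ p ∈ P, (s - p)) * fourierCoeffDelta L e dV hdV dW hdW νN β (S : Matrix (Fin n) (Fin n) L) (eisensteinFamilyDelta L e dV hdV dW hdW f s) h) ∧
      (∀ z : ℂ, 0 < z.re → ∀ h₀ : HA L e dV hdV dW hdW, ∃ r > (0 : ℝ), ∃ V ∈ 𝓝 h₀,
        ∃ m : skewMatrices ((IsCMField.complexConj L : L ≃ₐ[Fp L] L) : L →+* L) ((gramR L e dV hdV dW hdW).map (algebraMap (Fp L) L)) → ℝ, Summable m ∧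
          ∀ s : ℂ, dist s z < r → ∀ h ∈ V, ∀ S, ‖Ec₁ S s h‖ ≤ m S) ∧
      (∀ z : ℂ, 0 < z.re → ∃ C A r : ℝ, 0 < r ∧ ∀ s : ℂ, dist s z < r → ∀ h : HA L e dV hdV dW hdW,
        (Summable fun S => ‖Ec₁ S s h‖) ∧ ∑' S, ‖Ec₁ S s h‖ ≤ C * adelicHeightGL (n + n) L (h : GL (Fin (n + n)) (AdeleRing (𝓞 L) L)) ^ A) := by
  obtain ⟨Eb, ub, hEbd, hub, hubs, hbg, hEb⟩ := hK1b
  obtain ⟨ρa, G, Ea, uG, hG, hGρ, hEad, huG, huGs, haG, hEa⟩ := hK1a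
  exact exists_kindOne_sixLetters_of_cells L e dV hdV dW hdW hdV0 hdW0 hn hχ f hf hfc P hP wq hwq Eb hEbd ρa G hG hGρ Ea hEad ub uG hub huG
    hbg haG (hubs.add huGs) hEb hEa

end Summit.HodgeConjecture.HodgeConjecture.Cruxes.HLiu418.K2LiuSiegelEisensteinRankOneCellsAssembly

end
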